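import Summits.QuantumFields.BalabanUV.Beta.EriceRemainderEnclosureHistoryAutonomyComparisonAgeCompositionStaticChainSpikeFluid

/-!
# EriceRemainderEnclosureHistoryAutonomyComparisonAgeCompositionStaticChainPureSpikeMargin — (E73d) THE ZERO-PUMP ANCHOR: the worst-constant fluid of a pure
# adjacent spike (`Λ = 0`, `W_far = 0`) stays FINITE on the whole feasible range of the young age — `θ̄(1)·q(X) < 1` for `0 ≤ X ≤ 1∕(2c_max) = (√2+1)∕4` —
# because `(4 − 2√2)·log(1∕θ̄(1)) > (1 − θ̄(1))·log(2 + √2)` (a certified numerical margin of 7 %)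

Cell `pub-balaban`, β-function sub-cell, BINDER row D4 «RemainderConst leaves for Bałaban's split» (`HOME/BINDER-OWNERS.md`; owner lineage `b2b-balaban-beta-an4`;
this file by co-owner #2 lineage `b2b-balaban-beta-d4-p2`, generation 64), β-FLOW TEAM duty (1), FREEZE (0) honoured (def-free; imports (E72e) only to sit next to
the closed form it speaks about; Mathlib's `Real.abs_log_sub_add_sum_range_le`, `Real.exp_one_lt_d9`∕`gt_d9`, `Real.log_two_lt_d9` supply the enclosures).

HONEST FRAMING (page 1, verbatim and binding).  *"Discharging BetaPertH makes Bałaban's UV stability UNCONDITIONAL — a real constructive-QFT result; it is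
NOT the continuum limit and NOT the Clay problem."*  THIS FILE DISCHARGES NOTHING OF THE KIND.  A certified numerical inequality between explicit constants of
the census's own FIRST-ORDER static chain over NOT-IN-PRINT binders; the form, signs, ages and moments of Bałaban's (1.22) limit functional are NOT PRINTED ([I]
p. 298; GAPS G-t4-U2-1∕-2) and NOT asserted.  Row D4 class UNCHANGED (critical-path width 0; instance 0∕1; D4 DISCHARGE NO DATE).  HONEST DEPENDENCY: continuum
YM on T⁴ ⇐ BetaPertH ∧ nine spine estimates (0/9 proved); BetaPertH ⇐ (D1) ∧ (D4) ∧ CAP+tail; G-an2-4 gates asym, D1 and NE2/3/4.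

THE POINT (census sense (α); route (N); README `g64/e73` §5).  The constants of the crude budget-form chain at scale ratio → 1: persistence defect
`θ̄(1) = 1 − (1∕2)^{3∕2}e^{−1∕2} = 1 − (√2∕4)e^{−1∕2} = 0.78556`, so `a = 1 − θ̄(1) = (√2∕4)e^{−1∕2} = 0.21444`; window charge `c_max = 2(√2−1)`, `κ = √2·c_max = 4 − 2√2 =
1.17157`; the young age's feasibility under a spike of load `X` at ratio 1 ends at `X_f = 1∕(2c_max) = (√2+1)∕4 = 0.60355`, where `1 − κX_f = 1 − √2∕2`.  (E72e)'s
closed form with `Λ = 0`, `D₀ = 1` (`a + θ = 1`): `q(X) = e^{(a∕κ)(log 1 − log(1−κX))}`, finite compounding iff `θq < 1`.  §1 enclosures (`√2`, `e^{1∕2}`, `a`; the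
logarithmic series with remainder); §2 **`margin_ineq`**: `(4 − 2√2)·(−log(1 − a)) > a·(log 2 − log(2 − √2))` — i.e. `κ·log(1∕θ̄(1)) = 0.2828 > a·log(2+√2) =
0.2633`; §3 **`pure_spike_alive`**: for `0 ≤ X ≤ (√2+1)∕4`, `θ·q(X) < 1` — THE PURE ADJACENT SPIKE'S FLUID NEVER BLOWS UP WHILE THE YOUNG AGE IS FEASIBLE (the
blow-up load `X* = (1 − θ^{κ∕a})∕κ = 0.625` lies `0.021` beyond `X_f`; at `X_f` the fluid has `E = a q∕(1−θq) ≈ 16`).  This is the zero-pump anchor of README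
`g64/e73` §5: a far∕mid «pump» (`Λ > 0`, `W_far > 0`) lowers `X*`, the old scales' budgets lower `X_f`, and the continuum supremum of «young load × chain load»
lives in the gap.  NOT CLAIMED: anything with a pump, the near-window lemmas, (S1), MONO, anything nonlinear, anything printed.
-/
noncomputable section

open Finset Real

namespace Summit.QuantumFields.BalabanUV.Beta.EriceRemainderEnclosureHistoryAutonomyComparisonAgeCompositionStaticChainPureSpikeMargin

/-! ## §1 Enclosures -/

/-- `1.41421356 < √2 < 1.41421357`. [folklore] -/
theorem sqrt_two_bounds : (1.41421356 : ℝ) < Real.sqrt 2 ∧ Real.sqrt 2 < 1.41421357 := by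
  constructor
  · rw [Real.lt_sqrt (by norm_num)]; norm_num
  · rw [Real.sqrt_lt' (by norm_num)]; norm_num

/-- `1.6487212 < e^{1∕2} < 1.6487213` (from Mathlib's nine-digit enclosure of `e` and `(e^{1∕2})² = e`). [folklore] -/
theorem exp_half_bounds : (1.6487212 : ℝ) < Real.exp (1 / 2) ∧ Real.exp (1 / 2) < 1.6487213 := by
  have hsq : Real.exp (1 / 2) * Real.exp (1 / 2) = Real.exp 1 := by rw [← Real.exp_add]; norm_num
  have hpos : 0 < Real.exp (1 / 2) := Real.exp_pos _
  have h1 := Real.exp_one_gt_d9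
  have h2 := Real.exp_one_lt_d9
  constructor
  · by_contra h
    have h := not_lt.mp h
    nlinarith [mul_le_mul h h (hpos.le) (by norm_num)]
  · by_contra h
    have h := not_lt.mp h
    nlinarith [mul_le_mul h h (by norm_num) hpos.le]

/-- `a = (√2∕4)·e^{−1∕2} ∈ (0.214440, 0.214441)` — the complement `1 − θ̄(1)` of the persistence defect at scale ratio 1. [folklore] -/
theorem a_bounds {a : ℝ} (ha : a = Real.sqrt 2 / 4 * Real.exp (-(1 / 2))) : (0.214440 : ℝ) < a ∧ a < 0.214441 := by
  obtain ⟨hs1, hs2⟩ := sqrt_two_bounds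
  obtain ⟨he1, he2⟩ := exp_half_bounds
  have hpos : 0 < Real.exp (1 / 2) := Real.exp_pos _
  have hE : Real.exp (-(1 / 2 : ℝ)) = (Real.exp (1 / 2))⁻¹ := Real.exp_neg _
  have ha' : a * Real.exp (1 / 2) = Real.sqrt 2 / 4 := by
    rw [ha, hE, mul_assoc, inv_mul_cancel₀ hpos.ne', mul_one]
  constructor
  · by_contra h
    have h := not_lt.mp h
    nlinarith [mul_le_mul h he2.le hpos.le (by norm_num)]
  · by_contra h
    have h := not_lt.mp h
    nlinarith [mul_le_mul h he1.le (by norm_num) (by linarith)]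

/-- Third-order LOWER bound for `−log(1 − a)`, `0 ≤ a < 1`: `a + a²∕2 + a³∕3 − a⁴∕(1−a) ≤ −log(1−a)` (Mathlib's `Real.abs_log_sub_add_sum_range_le`, `n = 3`).
[folklore] -/
theorem neg_log_one_sub_ge {a : ℝ} (h0 : 0 ≤ a) (h1 : a < 1) :
    a + a ^ 2 / 2 + a ^ 3 / 3 - a ^ 4 / (1 - a) ≤ -Real.log (1 - a) := by
  have habs : |a| = a := abs_of_nonneg h0
  have h := Real.abs_log_sub_add_sum_range_le (x := a) (by rw [habs]; exact h1) 3
  rw [habs] at h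
  have hsum : ∑ i ∈ range 3, a ^ (i + 1) / ((i : ℝ) + 1) = a + a ^ 2 / 2 + a ^ 3 / 3 := by
    simp only [sum_range_succ, sum_range_zero]
    norm_num
  rw [hsum] at h
  have h' := (abs_le.mp h).2
  linarith

/-- Fourth-order UPPER bound for `−log(1 − x)`, `0 ≤ x < 1`: `−log(1−x) ≤ x + x²∕2 + x³∕3 + x⁴∕4 + x⁵∕(1−x)` (same lemma, `n = 4`). [folklore] -/
theorem neg_log_one_sub_le {x : ℝ} (h0 : 0 ≤ x) (h1 : x < 1) :
    -Real.log (1 - x) ≤ x + x ^ 2 / 2 + x ^ 3 / 3 + x ^ 4 / 4 + x ^ 5 / (1 - x) := by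
  have habs : |x| = x := abs_of_nonneg h0
  have h := Real.abs_log_sub_add_sum_range_le (x := x) (by rw [habs]; exact h1) 4
  rw [habs] at h
  have hsum : ∑ i ∈ range 4, x ^ (i + 1) / ((i : ℝ) + 1) = x + x ^ 2 / 2 + x ^ 3 / 3 + x ^ 4 / 4 := by
    simp only [sum_range_succ, sum_range_zero]
    norm_num
  rw [hsum] at h
  have h' := (abs_le.mp h).1
  linarith

/-! ## §2 The margin inequality -/

/-- **THE MARGIN INEQUALITY.**  With `a = (√2∕4)e^{−1∕2}` (`= 1 − θ̄(1)`): `(4 − 2√2)·(−log(1 − a)) > a·(log 2 − log(2 − √2))`, i.e.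
`κ·log(1∕θ̄(1)) > a·log(2 + √2)` (`0.2828 > 0.2633`; certified here as `0.27886 > 0.26699` from `a ∈ (0.214440, 0.214441)`, `√2 ∈ (1.41421356, 1.41421357)`,
`log 2 < 0.6931471808`, the series bounds of §1). [folklore] -/
theorem margin_ineq {a : ℝ} (ha : a = Real.sqrt 2 / 4 * Real.exp (-(1 / 2))) :
    a * (Real.log 2 - Real.log (2 - Real.sqrt 2)) < (4 - 2 * Real.sqrt 2) * (-Real.log (1 - a)) := by
  obtain ⟨hs1, hs2⟩ := sqrt_two_bounds
  obtain ⟨ha1, ha2⟩ := a_bounds ha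
  set s := Real.sqrt 2 with hs
  -- lower bound for −log(1−a)
  have hL1 := neg_log_one_sub_ge (a := a) (by linarith) (by linarith)
  have ha4 : a ^ 4 / (1 - a) ≤ (0.214441 : ℝ) ^ 4 / (1 - 0.214441) := by
    have h4 : a ^ 4 ≤ (0.214441 : ℝ) ^ 4 := by
      apply pow_le_pow_left₀ (by linarith) ha2.le
    exact div_le_div₀ (by norm_num) h4 (by norm_num) (by linarith)
  have hp1 : (0.214440 : ℝ) ≤ a := ha1.le
  have hp2 : (0.214440 : ℝ) ^ 2 ≤ a ^ 2 := pow_le_pow_left₀ (by norm_num) hp1 2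
  have hp3 : (0.214440 : ℝ) ^ 3 ≤ a ^ 3 := pow_le_pow_left₀ (by norm_num) hp1 3
  have hL1' : (0.238027 : ℝ) ≤ -Real.log (1 - a) := by
    have : (0.238027 : ℝ) ≤ a + a ^ 2 / 2 + a ^ 3 / 3 - a ^ 4 / (1 - a) := by
      nlinarith [hp1, hp2, hp3, ha4]
    linarith
  -- upper bound for −log(2 − s) = −log(1 − (s − 1))
  have hx0 : 0 ≤ s - 1 := by linarith
  have hx1 : s - 1 < 1 := by linarith
  have hL2 := neg_log_one_sub_le hx0 hx1
  have hxle : s - 1 ≤ 0.41421357 := by linarith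
  have hq2 : (s - 1) ^ 2 ≤ (0.41421357 : ℝ) ^ 2 := pow_le_pow_left₀ hx0 hxle 2
  have hq3 : (s - 1) ^ 3 ≤ (0.41421357 : ℝ) ^ 3 := pow_le_pow_left₀ hx0 hxle 3
  have hq4 : (s - 1) ^ 4 ≤ (0.41421357 : ℝ) ^ 4 := pow_le_pow_left₀ hx0 hxle 4
  have hq5 : (s - 1) ^ 5 / (1 - (s - 1)) ≤ (0.41421357 : ℝ) ^ 5 / (1 - 0.41421357) := by
    have h5 : (s - 1) ^ 5 ≤ (0.41421357 : ℝ) ^ 5 := pow_le_pow_left₀ hx0 hxle 5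
    exact div_le_div₀ (by norm_num) h5 (by norm_num) (by linarith)
  have h2s : (2 : ℝ) - s = 1 - (s - 1) := by ring
  have hL2' : -Real.log (2 - s) ≤ 0.551865 := by
    rw [h2s]
    have : s - 1 + (s - 1) ^ 2 / 2 + (s - 1) ^ 3 / 3 + (s - 1) ^ 4 / 4 + (s - 1) ^ 5 / (1 - (s - 1)) ≤ 0.551865 := by
      nlinarith [hxle, hq2, hq3, hq4, hq5]
    linarith
  have hlog2 := Real.log_two_lt_d9
  have hκ : (1.17157286 : ℝ) ≤ 4 - 2 * s := by linarith
  -- assemble: a·(log 2 + (−log(2−s))) ≤ 0.214441·(0.6931471808 + 0.551865) < 1.17157286·0.238027 ≤ κ·(−log(1−a))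
  have hR : a * (Real.log 2 - Real.log (2 - s)) ≤ 0.214441 * (0.6931471808 + 0.551865) := by
    have hsum : Real.log 2 - Real.log (2 - s) ≤ 0.6931471808 + 0.551865 := by linarith
    have hsum0 : 0 ≤ Real.log 2 - Real.log (2 - s) := by
      have : Real.log (2 - s) ≤ Real.log 2 := Real.log_le_log (by linarith) (by linarith)
      linarith
    nlinarith
  have hL : (1.17157286 : ℝ) * 0.238027 ≤ (4 - 2 * s) * (-Real.log (1 - a)) := by nlinarith
  have hnum : (0.214441 : ℝ) * (0.6931471808 + 0.551865) < 1.17157286 * 0.238027 := by norm_num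
  linarith

/-! ## §3 The pure adjacent spike's fluid is finite on the feasible range -/

/-- **THE PURE ADJACENT SPIKE NEVER BLOWS UP WHILE THE YOUNG AGE IS FEASIBLE.**  Constants of the crude chain at scale ratio 1 presented as hypotheses:
`a = (√2∕4)e^{−1∕2}` (`= 1 − θ̄(1)`), `θ = 1 − a` (`= θ̄(1)`), `κ = 4 − 2√2` (`= √2·2(√2−1)`).  Then for every spike load `X ≤ (√2+1)∕4` (`= 1∕(2c_max)`, the
largest load under which the young age's own budget `c_max·(x_z + X) ≤ ½` leaves `x_z ≥ 0`): **`θ·q(X) < 1`** with (E72e)'s `q(X) = e^{(a∕κ)(log 1 − log(1 − κX))}∕(a+θ)`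
(`Λ = 0`, `D₀ = 1`) — so the closed form `E(X) = a·q∕(1 − θq)` of the worst-constant adjacent-spike fluid is finite (and (E73a) `spike_le_closed_form` applies) on
the whole feasible range.  Proof: monotone in `X`; at `X = (√2+1)∕4`, `1 − κX = 1 − √2∕2` and the claim is `margin_ineq`. [folklore] -/
theorem pure_spike_alive {a θ κ X : ℝ} (ha : a = Real.sqrt 2 / 4 * Real.exp (-(1 / 2))) (hθ : θ = 1 - a) (hκ : κ = 4 - 2 * Real.sqrt 2)
    (hX : X ≤ (Real.sqrt 2 + 1) / 4) :
    θ * (Real.exp (a / κ * (Real.log 1 - Real.log (1 - κ * X))) / (a + θ)) < 1 := by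
  obtain ⟨hs1, hs2⟩ := sqrt_two_bounds
  obtain ⟨ha1, ha2⟩ := a_bounds ha
  have hm := margin_ineq ha
  set s := Real.sqrt 2 with hs
  have hss : s * s = 2 := Real.mul_self_sqrt (by norm_num)
  have hκ0 : 0 < κ := by rw [hκ]; linarith
  have haθ : a + θ = 1 := by rw [hθ]; ring
  have hθ0 : 0 < θ := by rw [hθ]; linarith
  -- 1 − κX ≥ 1 − κ(√2+1)/4 = 1 − √2/2 > 0
  have hκX : κ * X ≤ s / 2 := by
    have h1 : κ * X ≤ κ * ((s + 1) / 4) := mul_le_mul_of_nonneg_left hX hκ0.le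
    have h2 : κ * ((s + 1) / 4) = s / 2 := by rw [hκ]; nlinarith [hss]
    linarith
  have hD : 0 < 1 - κ * X := by linarith
  have hDf : 0 < 1 - s / 2 := by linarith
  -- the exponent is at most (a/κ)·(−log(1 − s/2)) = (a/κ)(log 2 − log(2 − s))
  have hlogmono : Real.log (1 - s / 2) ≤ Real.log (1 - κ * X) := Real.log_le_log hDf (by linarith)
  have hsplit : -Real.log (1 - s / 2) = Real.log 2 - Real.log (2 - s) := by
    have : (1 : ℝ) - s / 2 = (2 - s) / 2 := by ring
    rw [this, Real.log_div (by linarith) (by norm_num)]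
    ring
  have haκ0 : 0 ≤ a / κ := div_nonneg (by linarith) hκ0.le
  have hexp_le : a / κ * (Real.log 1 - Real.log (1 - κ * X)) ≤ a / κ * (Real.log 2 - Real.log (2 - s)) := by
    rw [Real.log_one, zero_sub, ← hsplit]
    exact mul_le_mul_of_nonneg_left (by linarith) haκ0
  -- margin: (a/κ)(log 2 − log(2−s)) < −log(1−a) = −log θ
  have hkey : a / κ * (Real.log 2 - Real.log (2 - s)) < -Real.log θ := by
    rw [hθ, div_mul_eq_mul_div, div_lt_iff₀ hκ0, ← hκ] at *
    linarith [hm]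
  rw [haθ, div_one]
  -- θ·e^{u} < 1 ⟸ u < −log θ
  have hu : a / κ * (Real.log 1 - Real.log (1 - κ * X)) < -Real.log θ := lt_of_le_of_lt hexp_le hkey
  calc θ * Real.exp (a / κ * (Real.log 1 - Real.log (1 - κ * X)))
      < θ * Real.exp (-Real.log θ) := mul_lt_mul_of_pos_left (Real.exp_lt_exp.mpr hu) hθ0
    _ = 1 := by rw [Real.exp_neg, Real.exp_log hθ0, mul_inv_cancel₀ hθ0.ne']

end Summit.QuantumFields.BalabanUV.Beta.EriceRemainderEnclosureHistoryAutonomyComparisonAgeCompositionStaticChainPureSpikeMargin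

end
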